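import Literature.AnabelianGeometry.EtaleTheta.Discharge.Sec2HasMuLIffTrivialAction
import Literature.AnabelianGeometry.EtaleTheta.Discharge.Sec1DeltaThetaZHat
import Literature.AnabelianGeometry.EtaleTheta.Discharge.Sec1ThetaCompactOfYcl
import Literature.AnabelianGeometry.EtaleTheta.SettingModelKrullCyclotomeModEmpty
import Literature.AnabelianGeometry.EtaleTheta.SettingModelKrullZNAllSplittings
import Literature.AnabelianGeometry.EtaleTheta.SettingModelKrullCusp
import Literature.AnabelianGeometry.EtaleTheta.SettingModelChiCyclotomes
import Mathlib.Topology.Algebra.Group.ClosedSubgroup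
import HarnessLib

/-!
# [EtTh] Def. 2.13's cyclotome datum `μ_N ≅ (1·Δ_Θ) ⊗ ℤ/N` EXISTS at every setting of [EtTh] origin whose `Π^tp_X` CENTRALISES `Δ_Θ`
# and whose `G_K` fixes `μ_N` — WITHOUT coordinates; hence the POSITIVE half of the `κ′` census: `CyclotomeMod 1 N` at `modelκ′`
# ⟺ `N ∣ p − 1 ∨ (p = 2 ∧ N = 2)` (proof-only)

S. Mochizuki, *The étale theta function and its Frobenioid-theoretic manifestations*, Publ. RIMS **45** (2009) [EtTh], §1 p. 12
(«`(Ẑ(1) ≅) Δ_Θ`», «abelian profinite groups»), §2 Def. 2.13 p. 46 («the natural isomorphism `μ_N ≅ (l·Δ_Θ) ⊗ (ℤ/Nℤ)`»)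
[cite: MochizukiEtTh2009, Def 2.13 p.46]; J.-P. Serre, *A course in arithmetic*, Ch. II §3.1 Prop. 7 [cite: Serre1973, Ch. II §3.1 Prop. 7].
Cell abc-iut, layer L2, seat abc-iut-L2-t10 (gen 7), row (N2) «CYCLOTOMEMOD (1,N) AT κ′ — POSITIVE HALF» (abc-iut-L2-lead gen 6 R724/R749),
closing K11 (`SettingModelKrullCyclotomeModEmpty`, gen 6) to an IFF. PROOF-ONLY (0 definitions; the datum is built inside `Nonempty`).

THE CONSTRUCTION (no `Ẑ`-coordinate of `Δ_Θ(κ′)` is needed — gen 6's ≈300-line estimate assumed one):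
* abc-iut-L2-d1's ABSTRACT `e : Δ_Θ ≃* Ẑ` (`IsEtThOrigin.nonempty_deltaTheta_mulEquiv_zHat` ⟸ origin + `hYcl`) and the level map
  `Ẑ → ℤ/N` followed by `k ↦ ε^k` for a primitive `ε ∈ μ_N(ℚ̄_p)` give `red : 1·Δ_Θ → μ_N`, ONTO, with kernel the `N`-th powers
  (`ZHatLevel.level_eq_one_iff_exists_pow`);
* CONTINUITY without coordinates: `Δ_Θ` is COMPACT (abc-iut-L2-d1/w5-d187's `isCompact_deltaTheta_of_groupLevelData` from the bundle
  `op : OncePuncturedData`) and `(Π^tp_X)^Θ` Hausdorff, so `Ker red` = the image of the `N`-th power map is compact, hence closed, of finite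
  index `N` — hence OPEN (Mathlib `Subgroup.isOpen_of_isClosed_of_finiteIndex`); a homomorphism to a discrete group with open kernel is
  locally constant;
* EQUIVARIANCE: both actions are trivial by hypothesis (`Π^tp_X` centralises `Δ_Θ`; `G_K` fixes `μ_N`).

RESULTS: `ThetaSetting.nonempty_cyclotomeMod_one_of_conj_eq` (generic); at the untwisted Krull model:
**`SettingModel.nonempty_cyclotomeMod_one_modelκ'_of`** (`N ∣ p − 1 ∨ (p = 2 ∧ N = 2)`; K7 centrality, abc-iut-w5-d125's
`galMuN_eq_one_iff`, `hYcl_modelκ'`, `CurveTheta.t2Space_GTheta`) and **`nonempty_cyclotomeMod_one_modelκ'_iff`** (with K11's negative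
half): the κ′ census of the Cor. 2.9 cyclotome binder is EXACT. The general `l`-parameter (`CyclotomeMod l N`, `l ≠ 1`) is NOT claimed.
HONEST LIMITS: semi-synthetic model = consistency evidence for the typed interface only; nothing of [EtTh] asserted; no side taken on
[IUTchIII] Cor. 3.12; typed ≠ proved.
-/

noncomputable section

open CategoryTheory ProfiniteGrp ProfiniteGrp.ProfiniteCompletion
open _root_.Topology _root_.Filter

namespace Literature.AnabelianGeometry.EtaleTheta

namespace ThetaSetting

open Literature.AnabelianGeometry.SemiGraphs

variable {p : ℕ} [Fact p.Prime] {D : ThetaSetting p}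

/-- **A level-`(1, N)` cyclotome datum EXISTS at every setting of [EtTh] origin (bundle `op`, closedness binder `hYcl`, Hausdorff
`(Π^tp_X)^Θ`) whose `Π^tp_X` centralises `Δ_Θ` and whose `Π^tp_X` fixes `μ_N(ℚ̄_p)` through `aug`** — built from abc-iut-L2-d1's
abstract `Δ_Θ ≃* Ẑ`, the level map and a primitive root; continuity from compactness of `Δ_Θ` (kernel = closed of finite index ⇒ open).
[cite: MochizukiEtTh2009, Def 2.13 p.46] -/
theorem nonempty_cyclotomeMod_one_of_conj_eq [T2Space D.GtpTheta] (op : D.OncePuncturedData)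
    (hYcl : (D.DtpY.map D.toHat.toMonoidHom).topologicalClosure ≤
      D.DtpY.map D.toHat.toMonoidHom ⊔ (⁅⁅D.DeltaHat, D.DeltaHat⁆, D.DeltaHat⁆).topologicalClosure) (N : ℕ+)
    (hconj : ∀ (σ : D.PiTemp) (a : D.GtpTheta), a ∈ D.DeltaTheta → D.toTheta σ * a * (D.toTheta σ)⁻¹ = a)
    (hgal : ∀ (σ : D.PiTemp) (m : MuN p N), galMuN p N (D.aug.toMonoidHom σ) m = m) :
    Nonempty (D.CyclotomeMod 1 N) := by
  classical
  haveI : NeZero (N : ℕ) := ⟨N.ne_zero⟩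
  -- abc-iut-L2-d1's abstract coordinate and the compactness of `Δ_Θ`
  obtain ⟨e⟩ := op.origin.nonempty_deltaTheta_mulEquiv_zHat hYcl
  have hcpt : IsCompact ((D.DeltaTheta : Subgroup D.GtpTheta) : Set D.GtpTheta) :=
    D.isCompact_deltaTheta_of_groupLevelData op.toGroupLevelData hYcl
  have h1 : D.lDeltaTheta 1 = D.DeltaTheta := D.lDeltaTheta_one
  haveI : CompactSpace ↥(D.lDeltaTheta 1) := isCompact_iff_compactSpace.mp (by rw [h1]; exact hcpt)
  -- a primitive `N`-th root of unity `ε ∈ μ_N(ℚ̄_p)` (abc-iut-w5-d125's device)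
  haveI : NeZero ((N : ℕ) : PadicAlgCl p) := ⟨by exact_mod_cast N.ne_zero⟩
  obtain ⟨ζ0, hζ0⟩ := HasEnoughRootsOfUnity.prim (M := PadicAlgCl p) (n := (N : ℕ))
  set ε : MuN p N := hζ0.toRootsOfUnity with hε
  have hεprim : IsPrimitiveRoot ε (N : ℕ) := by
    have hinj : Function.Injective
        ((Units.coeHom (PadicAlgCl p)).comp (rootsOfUnity N (PadicAlgCl p)).subtype) := by
      intro a b h
      exact Subtype.ext (Units.ext h)
    refine IsPrimitiveRoot.of_map_of_injective
      (f := (Units.coeHom (PadicAlgCl p)).comp (rootsOfUnity N (PadicAlgCl p)).subtype) ?_ hinj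
    show IsPrimitiveRoot (((ε : (PadicAlgCl p)ˣ)) : PadicAlgCl p) N
    rw [hε, IsPrimitiveRoot.val_toRootsOfUnity_coe]
    exact hζ0
  -- `k ↦ ε^k : ℤ/N → μ_N`
  let φ : Multiplicative (ZMod N) →* MuN p N :=
    { toFun := fun k => ε ^ (Multiplicative.toAdd k).val
      map_one' := by rw [toAdd_one, ZMod.val_zero, pow_zero]
      map_mul' := fun a b => by
        change ε ^ (Multiplicative.toAdd a + Multiplicative.toAdd b).val =
          ε ^ (Multiplicative.toAdd a).val * ε ^ (Multiplicative.toAdd b).val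
        rw [← pow_add, ZMod.val_add, ← pow_eq_pow_mod _ hεprim.pow_eq_one] }
  have hφ : ∀ k, φ k = ε ^ (Multiplicative.toAdd k).val := fun _ => rfl
  have hφ_ker : ∀ k : Multiplicative (ZMod N), φ k = 1 ↔ k = 1 := by
    intro k
    rw [hφ, hεprim.pow_eq_one_iff_dvd]
    constructor
    · intro h
      have hv : (Multiplicative.toAdd k).val = 0 := Nat.eq_zero_of_dvd_of_lt h (ZMod.val_lt _)
      rw [ZMod.val_eq_zero] at hv
      exact toAdd_eq_zero.mp hv
    · rintro rfl
      rw [toAdd_one, ZMod.val_zero]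
      exact dvd_zero _
  -- `red : 1·Δ_Θ → μ_N`
  let ψ : ↥(D.lDeltaTheta 1) ≃* ↥D.DeltaTheta := MulEquiv.subgroupCongr h1
  let red : ↥(D.lDeltaTheta 1) →* MuN p N :=
    φ.comp ((ZHatLevel.level N).comp (e.toMonoidHom.comp ψ.toMonoidHom))
  have hred : ∀ x, red x = φ (ZHatLevel.level N (e (ψ x))) := fun _ => rfl
  -- onto
  have hred_surj : Function.Surjective red := by
    intro u
    have huN : (((u : (PadicAlgCl p)ˣ)) : PadicAlgCl p) ^ (N : ℕ) = 1 := by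
      have h := (mem_rootsOfUnity _ _).mp u.2
      rw [← Units.val_pow_eq_pow_val, h, Units.val_one]
    obtain ⟨i, hi, hiu⟩ := hζ0.eq_pow_of_pow_eq_one huN
    refine ⟨ψ.symm (e.symm (ZHatLevel.eta (i : ℤ))), ?_⟩
    rw [hred, MulEquiv.apply_symm_apply, MulEquiv.apply_symm_apply, ZHatLevel.level_eta, hφ, toAdd_ofAdd,
      Int.cast_natCast, ZMod.val_natCast, Nat.mod_eq_of_lt hi]
    apply Subtype.ext
    apply Units.ext
    rw [← hiu, Subgroup.coe_pow, Units.val_pow_eq_pow_val, hε, IsPrimitiveRoot.val_toRootsOfUnity_coe]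
  -- kernel = the `N`-th powers
  have hred_ker : ∀ x, red x = 1 ↔ ∃ y : ↥(D.lDeltaTheta 1), x = y ^ (N : ℕ) := by
    intro x
    rw [hred, hφ_ker, ZHatLevel.level_eq_one_iff_exists_pow]
    constructor
    · rintro ⟨z, hz⟩
      refine ⟨ψ.symm (e.symm z), ψ.injective (e.injective ?_)⟩
      rw [map_pow, map_pow, MulEquiv.apply_symm_apply, MulEquiv.apply_symm_apply, hz]
    · rintro ⟨y, rfl⟩
      exact ⟨e (ψ y), by rw [map_pow, map_pow]⟩
  -- continuity: the kernel is closed (image of the `N`-th power map on a compact group) of finite index `N`, hence open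
  have hker_closed : IsClosed ((red.ker : Subgroup ↥(D.lDeltaTheta 1)) : Set ↥(D.lDeltaTheta 1)) := by
    have hrange : ((red.ker : Subgroup ↥(D.lDeltaTheta 1)) : Set ↥(D.lDeltaTheta 1)) =
        Set.range fun y : ↥(D.lDeltaTheta 1) => y ^ (N : ℕ) := by
      ext x
      rw [SetLike.mem_coe, MonoidHom.mem_ker, hred_ker, Set.mem_range]
      constructor
      · rintro ⟨y, rfl⟩
        exact ⟨y, rfl⟩
      · rintro ⟨y, rfl⟩
        exact ⟨y, rfl⟩
    rw [hrange]
    exact (isCompact_range (continuous_pow (N : ℕ))).isClosed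
  haveI : (red.ker : Subgroup ↥(D.lDeltaTheta 1)).FiniteIndex := by
    refine ⟨?_⟩
    rw [Subgroup.index_ker, MonoidHom.range_eq_top.mpr hred_surj, Subgroup.card_top, Nat.card_eq_fintype_card, card_MuN]
    exact N.ne_zero
  have hker_open : IsOpen ((red.ker : Subgroup ↥(D.lDeltaTheta 1)) : Set ↥(D.lDeltaTheta 1)) :=
    red.ker.isOpen_of_isClosed_of_finiteIndex hker_closed
  have hcont : Continuous red := by
    refine (IsLocallyConstant.iff_isOpen_fiber.mpr fun u => ?_).continuous
    rw [isOpen_iff_forall_mem_open]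
    intro y hy
    refine ⟨(fun k => y * k) '' (red.ker : Set ↥(D.lDeltaTheta 1)), ?_, (Homeomorph.mulLeft y).isOpenMap _ hker_open,
      ⟨1, one_mem _, mul_one y⟩⟩
    rintro _ ⟨k, hk, rfl⟩
    rw [Set.mem_preimage, Set.mem_singleton_iff, map_mul, (MonoidHom.mem_ker).mp hk, mul_one]
    exact hy
  -- assemble (equivariance: both actions are trivial)
  refine ⟨{ red := red
            red_surjective := hred_surj
            red_ker := hred_ker
            continuous_red := hcont
            red_conj := fun σ x => ?_ }⟩
  rw [hgal]
  exact congrArg red (Subtype.ext (hconj σ x (D.lDeltaTheta_le 1 x.2)))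

/-- The hypothesis «`Π^tp_X` fixes `μ_N(ℚ̄_p)` through `aug`» in the shape «`G_{ℚ_p}` acts trivially on `μ_N`»
(`galMuN p N = 1`, abc-iut-w5-d125's census `galMuN_eq_one_iff`: iff `N ∣ p − 1 ∨ (p = 2 ∧ N = 2)`).
[cite: Serre1973, Ch. II §3.1 Prop. 7] -/
theorem forall_galMuN_aug_eq_of_galMuN_eq_one {N : ℕ+} (h : galMuN p N = 1) (σ : D.PiTemp) (m : MuN p N) :
    galMuN p N (D.aug.toMonoidHom σ) m = m := by
  rw [h, MonoidHom.one_apply, MulAut.one_apply]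

end ThetaSetting

/-! ### The untwisted Krull model `κ′`: the positive half, and the exact census -/

namespace SettingModel

open Literature.AnabelianGeometry.SemiGraphs ThetaSetting

variable (p : ℕ) [Fact p.Prime]

/-- **`CyclotomeMod 1 N` is INHABITED at `modelκ′` for `N ∣ p − 1 ∨ (p = 2 ∧ N = 2)`** — `(Π^tp_X)^Θ` centralises `Δ_Θ` (K7
`toTheta_conj_eq_of_mem_deltaTheta_modelκ'`), `G_{ℚ_p}` fixes `μ_N` (`galMuN_eq_one_iff`), `hYcl_modelκ'`, the κ′ cusp bundle, and
`(Π^tp_X)^Θ` Hausdorff (`CurveTheta.t2Space_GTheta`). [cite: MochizukiEtTh2009, Def 2.13 p.46] -/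
theorem nonempty_cyclotomeMod_one_modelκ'_of (N : ℕ+) (hN : (N : ℕ) ∣ p - 1 ∨ (p = 2 ∧ (N : ℕ) = 2)) :
    Nonempty ((ThetaSetting.modelκ' p).CyclotomeMod 1 N) := by
  haveI : T2Space (ThetaSetting.modelκ' p).GtpTheta := CurveTheta.t2Space_GTheta (curveκ' p)
  exact nonempty_cyclotomeMod_one_of_conj_eq (nonempty_oncePuncturedData_modelκ' p).some (hYcl_modelκ' p) N
    (fun σ a ha => toTheta_conj_eq_of_mem_deltaTheta_modelκ' p _ a ha)
    (forall_galMuN_aug_eq_of_galMuN_eq_one ((galMuN_eq_one_iff p N).mpr hN))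

/-- **EXACT κ′ CENSUS of the cyclotome binder of Cor. 2.9's six-member count**: `CyclotomeMod 1 N` at `modelκ′` is inhabited IFF
`N ∣ p − 1 ∨ (p = 2 ∧ N = 2)` (negative half = K11 `isEmpty_cyclotomeMod_modelκ'_of_not`). [cite: MochizukiEtTh2009, Def 2.13 p.46] -/
theorem nonempty_cyclotomeMod_one_modelκ'_iff (N : ℕ+) :
    Nonempty ((ThetaSetting.modelκ' p).CyclotomeMod 1 N) ↔ (N : ℕ) ∣ p - 1 ∨ (p = 2 ∧ (N : ℕ) = 2) := by
  refine ⟨fun h => ?_, nonempty_cyclotomeMod_one_modelκ'_of p N⟩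
  by_contra hN
  exact (isEmpty_cyclotomeMod_modelκ'_of_not p 1 N hN).false h.some

/-- For ODD `l`: the K8 binder `μ : CyclotomeMod 1 l` at `κ′` is inhabited iff `l ∣ p − 1` (K11's `…_of_odd_not_dvd` + the positive half).
[cite: MochizukiEtTh2009, Def 2.13 p.46] -/
theorem nonempty_cyclotomeMod_one_modelκ'_iff_of_odd (l : ℕ+) (hodd : Odd (l : ℕ)) :
    Nonempty ((ThetaSetting.modelκ' p).CyclotomeMod 1 l) ↔ (l : ℕ) ∣ p - 1 := by
  rw [nonempty_cyclotomeMod_one_modelκ'_iff]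
  refine ⟨fun h => h.elim id fun h2 => ?_, Or.inl⟩
  rw [h2.2] at hodd
  exact absurd even_two (Nat.not_even_iff_odd.mpr hodd)

/-- The same datum read on the `MuTwoSetting` of the κ′ R-row (`(inversionModelκ′ p).toThetaSetting = modelκ′ p`, `rfl`).
[cite: MochizukiEtTh2009, Def 2.13 p.46] -/
theorem nonempty_cyclotomeMod_one_inversionModelκ'_of (N : ℕ+) (hN : (N : ℕ) ∣ p - 1 ∨ (p = 2 ∧ (N : ℕ) = 2)) :
    Nonempty ((MuTwoSetting.inversionModelκ' p).toThetaSetting.CyclotomeMod 1 N) :=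
  nonempty_cyclotomeMod_one_modelκ'_of p N hN

end SettingModel

end Literature.AnabelianGeometry.EtaleTheta

end
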